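import Literature.AnabelianGeometry.SemiGraphs.PiPresentationBridge
import HarnessLib

/-!
# [SemiAnbd] §2/§3: morphisms of profinite presentations as morphisms of semi-graphs of anabelioids

Mochizuki, *Semi-graphs of anabelioids*, Publ. RIMS **42** (2006), Def. 2.1 p. 22 ("evident notion
of morphism"), Rmk. 2.4.2 p. 26 (components `φ_v`, `φ_e` and 2-isomorphisms `φ_b`)
[cite: MochizukiSemiAnbd2006, Rmk 2.4.2 p.26].  The tree has two renderings of a morphism of
semi-graphs of anabelioids: the §3 one, `ProfiniteSemiGraph.Hom` (`TemperedVerticial.lean`: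
continuous homomorphisms `Π_v → Π_{f v}`, `Π_e → Π_{f e}` compatible with the `b_*` UP TO
CONJUGATION by some `g ∈ Π_{f v}`), and the §2 one, `SemiGraphOfAnabelioids.Hom`
(`GraphOfAnabelioids.lean`: exact pull-back functors and 2-isomorphisms `φ_b`).  This file
CONSTRUCTS the §2 morphism `F.toAnab : 𝒢.toAnab ⟶ ℋ.toAnab` of a §3 morphism `F : 𝒢 ⟶ ℋ`:
`φ_v := B(F_v)` (restriction), `φ_e := B(F_e)`, and `φ_b :=` the natural isomorphism
`res(F_v ∘ b_*) ≅ res(b'_* ∘ F_e)` given by "act by `g⁻¹`" for a conjugating element `g`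
(`resIsoOfConj`: restrictions along conjugate homomorphisms are isomorphic functors).
This is the morphism-level half of the §2/§3 presentation bridge (`PiPresentationBridge*.lean`).
-/

noncomputable section

namespace Literature.AnabelianGeometry.Anabelioids

open CategoryTheory CategoryTheory.Limits
open Literature.AlgebraicGeometry.Frobenioids (BCat)
open scoped FintypeCatDiscrete Pointwise

universe u

section ResConj

variable {K L : Type u} [Group K] [TopologicalSpace K] [Group L] [TopologicalSpace L]

/-- Restriction functors `B(K) → B(L)` along CONJUGATE continuous homomorphisms
`ψ₁ = g · ψ₂ · g⁻¹` are naturally isomorphic, via "act by `g⁻¹`" ([SemiAnbd] Rmk 2.4.2: the `φ_b`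
are determined by conjugating elements; [GeoAn] Prop. 1.1.4). [cite: MochizukiSemiAnbd2006, Rmk 2.4.2 p.26] -/
def resIsoOfConj (ψ₁ ψ₂ : L →ₜ* K) (g : K) (h : ∀ x, ψ₁ x = g * ψ₂ x * g⁻¹) :
    ContAction.res FintypeCat.{u} ψ₁ ≅ ContAction.res FintypeCat.{u} ψ₂ :=
  NatIso.ofComponents
    (fun X => ObjectProperty.isoMk _ (Action.mkIso
      (FintypeCat.equivEquivIso (MulAction.toPerm (g⁻¹ : K) : X.obj.V ≃ X.obj.V))
      (fun a => by
        apply FintypeCat.hom_ext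
        intro x
        change X.obj.V at x
        change g⁻¹ • ((ψ₁ a : K) • x) = (ψ₂ a : K) • (g⁻¹ • x)
        rw [h a, smul_smul, smul_smul, ← mul_assoc, ← mul_assoc, inv_mul_cancel, one_mul])))
    (fun {X Y} f => by
      apply (ObjectProperty.ι _).map_injective
      apply Action.Hom.ext
      apply FintypeCat.hom_ext
      intro x
      change X.obj.V at x
      change g⁻¹ • (f.hom.hom x : Y.obj.V) = f.hom.hom (g⁻¹ • x)
      exact (Induction.hom_smul f.hom g⁻¹ x).symm)

/-- Components of `resIsoOfConj`: act by `g⁻¹`. [cite: MochizukiSemiAnbd2006, Rmk 2.4.2 p.26] -/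
@[simp] theorem resIsoOfConj_hom_app_apply (ψ₁ ψ₂ : L →ₜ* K) (g : K)
    (h : ∀ x, ψ₁ x = g * ψ₂ x * g⁻¹) (X : BCat K) (x : X.obj.V) :
    ((resIsoOfConj ψ₁ ψ₂ g h).hom.app X).hom.hom x = (g⁻¹ • x : X.obj.V) := rfl

/-- Components of the inverse of `resIsoOfConj`: act by `g`. [cite: MochizukiSemiAnbd2006, Rmk 2.4.2 p.26] -/
@[simp] theorem resIsoOfConj_inv_app_apply (ψ₁ ψ₂ : L →ₜ* K) (g : K)
    (h : ∀ x, ψ₁ x = g * ψ₂ x * g⁻¹) (X : BCat K) (x : X.obj.V) :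
    ((resIsoOfConj ψ₁ ψ₂ g h).inv.app X).hom.hom x = (g • x : X.obj.V) := by
  change (MulAction.toPerm (g⁻¹ : K)).symm x = g • x
  rw [MulAction.toPerm_symm_apply, inv_inv]

end ResConj

end Literature.AnabelianGeometry.Anabelioids

namespace Literature.AnabelianGeometry.SemiGraphs

open CategoryTheory CategoryTheory.Limits
open Literature.AnabelianGeometry.Anabelioids
open Literature.AlgebraicGeometry.Frobenioids (BCat)
open scoped FintypeCatDiscrete Pointwise

universe u

namespace ProfiniteSemiGraph

variable {𝒢 ℋ : ProfiniteSemiGraph.{u}}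

/-- The edge homomorphism of a §3 morphism at a PRESENTED target edge `e'` (`f e = e'`), as the
§2 morphisms index their edge components. [cite: MochizukiSemiAnbd2006, Rmk 2.4.2 p.26] -/
def Hom.hE' (F : Hom 𝒢 ℋ) (e : 𝒢.graph.Edge) (e' : ℋ.graph.Edge) (h : F.base.edgeMap e = e') :
    𝒢.Ge e →ₜ* ℋ.Ge e' := h ▸ F.hE e

/-- At the tautological presentation, `hE'` is `hE`. [cite: MochizukiSemiAnbd2006, Rmk 2.4.2 p.26] -/
@[simp] theorem Hom.hE'_rfl (F : Hom 𝒢 ℋ) (e : 𝒢.graph.Edge) :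
    F.hE' e (F.base.edgeMap e) rfl = F.hE e := rfl

/-- `hE'` on elements is the transported value of `hE`. [cite: MochizukiSemiAnbd2006, Rmk 2.4.2 p.26] -/
theorem Hom.hE'_apply (F : Hom 𝒢 ℋ) (e : 𝒢.graph.Edge) (e' : ℋ.graph.Edge)
    (h : e' = F.base.edgeMap e) (x : 𝒢.Ge e) : F.hE' e e' h.symm x = h ▸ F.hE e x := by
  subst h
  rfl

/-- A conjugating element `g ∈ Π_{f v}` witnessing the compatibility of `F` with the branch maps at
`b` (chosen). [cite: MochizukiSemiAnbd2006, Rmk 2.4.2 p.26] -/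
def Hom.conjElt (F : Hom 𝒢 ℋ) (b : 𝒢.graph.Branch) (v : 𝒢.graph.Vertex)
    (h : 𝒢.graph.abuts b = some v) : ℋ.Gv (F.base.vertexMap v) :=
  Classical.choose (F.comm b v h)

/-- The defining property of `conjElt`, with the edge component at the presented edge
`ℋ.edgeOf (f b)`. [cite: MochizukiSemiAnbd2006, Rmk 2.4.2 p.26] -/
theorem Hom.conjElt_spec (F : Hom 𝒢 ℋ) (b : 𝒢.graph.Branch) (v : 𝒢.graph.Vertex)
    (h : 𝒢.graph.abuts b = some v) (x : 𝒢.Ge (𝒢.graph.edgeOf b)) :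
    ((F.hV v).comp (𝒢.brHom b v h)) x =
      F.conjElt b v h *
        ((ℋ.brHom (F.base.branchMap b) (F.base.vertexMap v) (F.base.abuts_branchMap b v h)).comp
          (F.hE' (𝒢.graph.edgeOf b) (ℋ.graph.edgeOf (F.base.branchMap b))
            (F.base.edgeOf_branchMap b).symm)) x * (F.conjElt b v h)⁻¹ := by
  have h1 := Classical.choose_spec (F.comm b v h) x
  change F.hV v (𝒢.brHom b v h x) = F.conjElt b v h *
    ℋ.brHom (F.base.branchMap b) (F.base.vertexMap v) (F.base.abuts_branchMap b v h)
      (F.hE' (𝒢.graph.edgeOf b) (ℋ.graph.edgeOf (F.base.branchMap b))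
        (F.base.edgeOf_branchMap b).symm x) * (F.conjElt b v h)⁻¹
  rw [Hom.hE'_apply F _ _ (F.base.edgeOf_branchMap b)]
  exact h1

/-- **The §2 morphism of a §3 morphism**: `F.toAnab : 𝒢.toAnab ⟶ ℋ.toAnab` with `φ_v = B(F_v)`,
`φ_e = B(F_e)` and `φ_b` the "act by `g⁻¹`" isomorphism for the conjugating element `g = conjElt`.
[cite: MochizukiSemiAnbd2006, Rmk 2.4.2 p.26] -/
def Hom.toAnab (F : Hom 𝒢 ℋ) : SemiGraphOfAnabelioids.Hom 𝒢.toAnab ℋ.toAnab where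
  base := F.base
  φV v := bCatMap (F.hV v)
  φE e e' h := bCatMap (F.hE' e e' h)
  φB b v h :=
    (ContAction.resComp FintypeCat.{u} (𝒢.brHom b v h) (F.hV v)).symm ≪≫
      resIsoOfConj _ _ (F.conjElt b v h) (F.conjElt_spec b v h) ≪≫
      ContAction.resComp FintypeCat.{u}
        (F.hE' (𝒢.graph.edgeOf b) (ℋ.graph.edgeOf (F.base.branchMap b))
          (F.base.edgeOf_branchMap b).symm)
        (ℋ.brHom (F.base.branchMap b) (F.base.vertexMap v) (F.base.abuts_branchMap b v h))

/-- `F.toAnab` has the same underlying morphism of semi-graphs. [cite: MochizukiSemiAnbd2006, Rmk 2.4.2 p.26] -/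
@[simp] theorem Hom.toAnab_base (F : Hom 𝒢 ℋ) : F.toAnab.base = F.base := rfl

/-- The vertex components of `F.toAnab` are the restriction functors `res (F_v)`.
[cite: MochizukiSemiAnbd2006, Rmk 2.4.2 p.26] -/
@[simp] theorem Hom.toAnab_φV_pullback (F : Hom 𝒢 ℋ) (v : 𝒢.graph.Vertex) :
    (F.toAnab.φV v).pullback = ContAction.res FintypeCat.{u} (F.hV v) := rfl

/-- The edge components of `F.toAnab` are the restriction functors `res (F_e)` (at a presented
target edge). [cite: MochizukiSemiAnbd2006, Rmk 2.4.2 p.26] -/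
@[simp] theorem Hom.toAnab_φE_pullback (F : Hom 𝒢 ℋ) (e : 𝒢.graph.Edge) (e' : ℋ.graph.Edge)
    (h : F.base.edgeMap e = e') :
    (F.toAnab.φE e e' h).pullback = ContAction.res FintypeCat.{u} (F.hE' e e' h) := rfl

/-- The 2-cells of `F.toAnab` act by `g⁻¹` on underlying sets (`g = conjElt`).
[cite: MochizukiSemiAnbd2006, Rmk 2.4.2 p.26] -/
theorem Hom.toAnab_φB_hom_app_apply (F : Hom 𝒢 ℋ) (b : 𝒢.graph.Branch) (v : 𝒢.graph.Vertex)
    (h : 𝒢.graph.abuts b = some v) (X : BCat (ℋ.Gv (F.base.vertexMap v))) (x : X.obj.V) :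
    ((F.toAnab.φB b v h).hom.app X).hom.hom x = ((F.conjElt b v h)⁻¹ • x : X.obj.V) := rfl

end ProfiniteSemiGraph

end Literature.AnabelianGeometry.SemiGraphs

end
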